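import Mathlib.LinearAlgebra.Matrix.NonsingularInverse
import Mathlib.LinearAlgebra.LinearIndependent.Basic
import Mathlib.Data.Complex.Basic
import Summits.MatrixMultiplication.MatrixMultiplication.Theses.SemilatticeSTPP

/-!
# `SemilatticeRank` — the multiplication table of a finite semilattice has rank `≤ |M|`

Route `MatrixMultiplication/SemilatticeSTPP`, item `stmt-MatrixMultiplication-5975` (support):
for a finite commutative idempotent monoid `M` (a finite semilattice with identity; order
`x ≤ w :↔ x w = w`, product = join) the structure tensor `T_M = groupTensor ℂ M` of `ℂ[M]`
(entry `[x y = z]` at `(z, x, y)`) has tensor rank at most `|M|`.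

Proof (Solomon 1967, Thm. 1 / Möbius inversion; Steinberg 2016, Ch. 9 for inverse monoids).
For `w ∈ M` the indicator `χ_w(x) = [x ≤ w]` is a character `M →* ℂ`, because
`x y ≤ w ↔ x ≤ w ∧ y ≤ w` (`semilatticeRank_mul_le_iff`), and `w ↦ χ_w` is injective
(`χ_w(w') = χ_{w'}(w') = 1` and symmetrically force `w = w w' = w'`).  By Dedekind's linear
independence of characters (`linearIndependent_monoidHom`) the `|M|` rows `χ_w` of the zeta
matrix `Z_{w,x} = [x ≤ w]` are linearly independent, so `Z` is invertible and `μ := Z⁻¹`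
satisfies `∑_w μ_{z,w} [v ≤ w] = [v = z]` (`semilatticeRank_exists_moebius`; `μ` is the Möbius
function of `(M, ≤)`).  Substituting `v = x y` and splitting `[x y ≤ w] = [x ≤ w][y ≤ w]` gives
the decomposition into `|M|` triads
`[x y = z] = ∑_w μ_{z,w} · [x ≤ w] · [y ≤ w]`, whence `R(T_M) ≤ |M|`
(`tensorRank_le_card_of_eq_sum`).  No partial-order instance on `M` is introduced: the only
order-theoretic input is the invertibility of the zeta matrix, obtained from the characters.
-/

-- single-conjunct summit: the mandated namespace `Summit.MatrixMultiplication.MatrixMultiplication.…`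
-- repeats `MatrixMultiplication` (summit = sub-problem), which `linter.dupNamespace` would flag.
set_option linter.dupNamespace false

namespace Summit.MatrixMultiplication.MatrixMultiplication.Theorems

open scoped BigOperators

/-- If `x x = x` in a commutative monoid then `x y w = w → x w = w` (`x y ≤ w ⇒ x ≤ w` for the
semilattice order `x ≤ w :↔ x w = w`): multiply `x y w = w` by `x` on the left. [folklore] -/
theorem semilatticeRank_le_of_mul_le {M : Type*} [CommMonoid M] (h : ∀ x : M, x * x = x)
    {x y w : M} (hxy : x * y * w = w) : x * w = w := by
  have key := congrArg (x * ·) hxy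
  simp only [← mul_assoc, h x] at key
  rw [hxy] at key
  exact key.symm

/-- In a commutative idempotent monoid, `x y ≤ w ↔ x ≤ w ∧ y ≤ w` for the semilattice order
`x ≤ w :↔ x w = w` (the product is the join). [folklore] -/
theorem semilatticeRank_mul_le_iff {M : Type*} [CommMonoid M] (h : ∀ x : M, x * x = x)
    (x y w : M) : x * y * w = w ↔ x * w = w ∧ y * w = w := by
  constructor
  · intro hxy
    refine ⟨semilatticeRank_le_of_mul_le h hxy, semilatticeRank_le_of_mul_le h (y := x) ?_⟩
    rwa [mul_comm y x]
  · rintro ⟨hx, hy⟩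
    rw [mul_assoc, hy, hx]

/-- **Möbius inversion on a finite semilattice** (Solomon 1967, Thm. 1; Steinberg 2016, Ch. 9):
for a finite commutative idempotent monoid `M` there are coefficients `μ_{z,w} ∈ ℂ` (the Möbius
function of `x ≤ w :↔ x w = w`, i.e. the inverse of the zeta matrix `Z_{w,x} = [x ≤ w]`) with
`∑_w μ_{z,w} [v ≤ w] = [v = z]` for all `v, z`.  The zeta matrix is invertible because its rows
`x ↦ [x ≤ w]` are `|M|` distinct characters `M →* ℂ`, linearly independent by Dedekind's lemma.
[cite: Solomon1967, Thm. 1] -/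
theorem semilatticeRank_exists_moebius (M : Type*) [CommMonoid M] [Fintype M] [DecidableEq M]
    (h : ∀ x : M, x * x = x) :
    ∃ μ : M → M → ℂ, ∀ v z : M,
      (∑ w, μ z w * (if v * w = w then (1 : ℂ) else 0)) = if v = z then 1 else 0 := by
  -- the characters `χ_w(x) = [x ≤ w]`
  let χ : M → (M →* ℂ) := fun w =>
    { toFun := fun x => if x * w = w then 1 else 0
      map_one' := by simp
      map_mul' := fun x y => by
        by_cases hx : x * w = w <;> by_cases hy : y * w = w <;>
          simp [hx, hy, semilatticeRank_mul_le_iff h x y w] }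
  have hχ_apply : ∀ w x, χ w x = if x * w = w then (1 : ℂ) else 0 := fun _ _ => rfl
  have hinj : Function.Injective χ := by
    intro w w' hww'
    have h1 := congrArg (fun f : M →* ℂ => f w) hww'
    have h2 := congrArg (fun f : M →* ℂ => f w') hww'
    simp only [hχ_apply, h w, h w', if_true] at h1 h2
    have e1 : w * w' = w' := by
      by_contra hc
      simp [hc] at h1
    have e2 : w' * w = w := by
      by_contra hc
      simp [hc] at h2
    calc w = w' * w := e2.symm
      _ = w * w' := mul_comm _ _
      _ = w' := e1
  have hli : LinearIndependent ℂ (fun w => (χ w : M → ℂ)) :=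
    (linearIndependent_monoidHom M ℂ).comp χ hinj
  -- the zeta matrix, rows indexed by `w`: `Z w x = [x ≤ w] = χ_w(x)`
  let Z : Matrix M M ℂ := Matrix.of fun w x => if x * w = w then (1 : ℂ) else 0
  have hZ_apply : ∀ w x, Z w x = if x * w = w then (1 : ℂ) else 0 := fun _ _ => rfl
  have hZrow : Z.row = fun w => (χ w : M → ℂ) := by
    funext w x
    rfl
  have hU : IsUnit Z := by
    rw [← Matrix.linearIndependent_rows_iff_isUnit, hZrow]
    exact hli
  have hdet : IsUnit Z.det := (Matrix.isUnit_iff_isUnit_det Z).mp hU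
  refine ⟨fun z w => (Z⁻¹ : Matrix M M ℂ) z w, fun v z => ?_⟩
  show (∑ w, (Z⁻¹ : Matrix M M ℂ) z w * (if v * w = w then (1 : ℂ) else 0)) = _
  have key := congrFun (congrFun (Matrix.nonsing_inv_mul Z hdet) z) v
  rw [Matrix.mul_apply, Matrix.one_apply] at key
  simp only [hZ_apply] at key
  exact key.trans (if_congr eq_comm rfl rfl)

/-- **Settles `stmt-MatrixMultiplication-5975`** (exact route signature
`Summit.MatrixMultiplication.MatrixMultiplication.Theses.SemilatticeSTPP.SemilatticeRank`):
for every finite commutative idempotent monoid `M`,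
`tensorRank (groupTensor ℂ M) ≤ |M|` — the multiplication table `[x y = z]` is the sum of the
`|M|` triads `(z ↦ μ_{z,w}) ⊗ (x ↦ [x ≤ w]) ⊗ (y ↦ [y ≤ w])`, `w ∈ M`, by Möbius inversion
`[v = z] = ∑_w μ_{z,w} [v ≤ w]` at `v = x y` and `[x y ≤ w] = [x ≤ w][y ≤ w]`
(Solomon 1967, Thm. 1: `ℂ[M] ≅ ℂ^{|M|}` for a finite semilattice). [cite: Solomon1967, Thm. 1] -/
theorem SemilatticeRank_proof :
    Summit.MatrixMultiplication.MatrixMultiplication.Theses.SemilatticeSTPP.SemilatticeRank := by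
  unfold Summit.MatrixMultiplication.MatrixMultiplication.Theses.SemilatticeSTPP.SemilatticeRank
  intro M _ _ _ hidem
  obtain ⟨μ, hμ⟩ := semilatticeRank_exists_moebius M hidem
  refine Literature.Computability.AlgebraicComplexity.tensorRank_le_card_of_eq_sum
    (fun w z => μ z w) (fun w x => if x * w = w then (1 : ℂ) else 0)
    (fun w y => if y * w = w then (1 : ℂ) else 0) ?_
  funext z x y
  rw [Finset.sum_apply, Finset.sum_apply, Finset.sum_apply]
  simp only [Literature.Computability.AlgebraicComplexity.triad_apply,
    Literature.Computability.AlgebraicComplexity.groupTensor_apply]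
  rw [← hμ (x * y) z]
  refine Finset.sum_congr rfl fun w _ => ?_
  have hsplit : (if x * y * w = w then (1 : ℂ) else 0) =
      (if x * w = w then (1 : ℂ) else 0) * (if y * w = w then (1 : ℂ) else 0) := by
    by_cases hx : x * w = w <;> by_cases hy : y * w = w <;>
      simp [hx, hy, semilatticeRank_mul_le_iff hidem x y w]
  rw [hsplit, mul_assoc]

end Summit.MatrixMultiplication.MatrixMultiplication.Theorems
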